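import Summits.BirchSwinnertonDyer.BirchSwinnertonDyer.Theorems.BiquadraticEisensteinDescentManinDatumSupercuspidalCMInertResolventOrbitSumJZero
import HarnessLib

set_option linter.dupNamespace false -- `Summit.BirchSwinnertonDyer.BirchSwinnertonDyer.Theorems.…` (summit = sub, D-0017)
set_option autoImplicit false

/-!
# Crux `ManinDatumSupercuspidalCMInert` (stmt-BirchSwinnertonDyer-20111, BED r605), stub `stub_S5` (`j = 0` at `p = 5`) — ★ THE RESOLVENT BOUND
# RES₅ AND THE CM CORE OF THE `j = 0` CELL, UNCONDITIONALLY, for every weight with the axioms of `(·/5)₆^k`, `k ∈ {1, …, 5}`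

Route `BiquadraticEisensteinDescent` (cell `pub/bsd-wall`, width seat `bsd-wall-cm-bed-w1` g8; `--supports` stmt-BirchSwinnertonDyer-20111,
helper). THEOREMS ONLY (no definition, no named fact, no `sorry`); nothing here proves the stub (its E-side, a `ℤ[ω]` theta dictionary
`H₅ ⟸ T₅`, is not in the tree), the crux, Manin's conjecture or BSD.

Assembly of the `j = 0` resolvent certificate: orbit form (`…ResolventOrbitSumJZero.resolventSum_rho_eq_six_mul`) + analytic labels
(`…ResolventLabelsJZero.pi_e_one/two/three`) + algebraic sums (`…ResolventCertificateAlgebraJZero.sum_k_n`) give, for the seven at-issue pairs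
`(k,n)`, `R_n^{(k)} = Q_{k,n}(π₀)` with `π₀ = X(1/5)⁻¹`, `v(π₀)¹² = v 5` (p641325); the `5`-adic READOUT of the explicit rational polynomials
`Q_{k,n}` (each monomial `q·π₀^j` has `12·ord₅(q) + j ≥ 12 − 2k`) gives `v(R_n^{(k)})⁶ ≤ v(5)^{6−k}`; the range reduction p644272 does the rest.

* `val_monomial_pow_six_le`, `val_coeff_le` — readout bookkeeping; `readout_k_n` — the seven readouts;
* ★ `resolventBound_rho_small_of_character` — RES₅fin for every `Φ : (ℤ/5)² → ℂ` with `Φ 0 = 0`, `Φ(0,1) = 1`, `Φ(−d) = Φ d`,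
  `Φ(d₂−d₁, −d₁) = ρ^kΦ(d)`, `Φ(2d₁−d₂, d₁+d₂) = (−ρ²)^kΦ(d)`, `1 ≤ k ≤ 5`;
* `rho_isIntegral`, `phi_isIntegral`, `phi_sum_eq_zero` — the axioms force algebraic-integer values and (for `1 ≤ k ≤ 5`) `Σ_d Φ(d) = 0`;
* ★★ `core_rho_of_character` — for such `Φ` (the five axioms and `1 ≤ k ≤ 5`, no further hypothesis):
  for every `M′` coprime to `5` and every `w` with `M′w ∈ ℤρ + ℤ`, `∃ s ∈ ℕ, 5 ∤ s, s·(Σ_d Φ(d)·E₁(w − t_d; ℤρ + ℤ))/(ϖ₁·5^{(6−k)/6}) ∈ ℤ̄` —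
  the Bézout-free CM core `Core₅` of `stub_S5`, the `j = 0` twin of the (still open) `Core₇` of `stub_S7`, PROVED.
[cite: Serre1979, Ch. IV §2 Prop. 7] [cite: Rubin1999, §7.4 Prop. 7.12] [cite: Lawden1989, §9.8 eq. (9.8.14)]
-/

noncomputable section

open scoped Classical
open Complex PeriodPair
open Literature.NumberTheory.EllipticCurves

namespace Summit.BirchSwinnertonDyer.BirchSwinnertonDyer.Theorems.BiquadraticEisensteinDescentManinDatumSupercuspidalCMInertResolventCertificateJZero

open Summit.BirchSwinnertonDyer.BirchSwinnertonDyer.Theorems.BiquadraticEisensteinDescentManinDatumSupercuspidalCMInertSevenDivisionEisenstein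
  (val_intCast_le_one)
open Summit.BirchSwinnertonDyer.BirchSwinnertonDyer.Theorems.BiquadraticEisensteinDescentManinDatumSupercuspidalCMInertTorsionCoreOfResolventBound
  (val_add_pow_le)
open Summit.BirchSwinnertonDyer.BirchSwinnertonDyer.Theorems.BiquadraticEisensteinDescentManinDatumSupercuspidalCMInertFiveDivisionEisensteinJZero
  (val_weierstrassP_five_div_rho)
open Summit.BirchSwinnertonDyer.BirchSwinnertonDyer.Theorems.BiquadraticEisensteinDescentManinDatumSupercuspidalCMInertTorsionCoordinatesJZero
  (val_natCast_eq_one_of_coprime five_mul_divPointRho_mem divPointRho_notMem)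
open Summit.BirchSwinnertonDyer.BirchSwinnertonDyer.Theorems.BiquadraticEisensteinDescentManinDatumSupercuspidalCMInertResolventBoundReductionJZero
  (core_rho_of_smallResolventBound)
open Summit.BirchSwinnertonDyer.BirchSwinnertonDyer.Theorems.BiquadraticEisensteinDescentManinDatumSupercuspidalCMInertResolventCertificateAlgebraJZero
  (sum_1_1 sum_1_4 sum_1_7 sum_2_2 sum_2_5 sum_3_3 sum_4_1)
open Summit.BirchSwinnertonDyer.BirchSwinnertonDyer.Theorems.BiquadraticEisensteinDescentManinDatumSupercuspidalCMInertResolventLabelsJZero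
  (e_ne_zero F_of_divPointRho pi_e_one pi_e_two pi_e_three)
open Summit.BirchSwinnertonDyer.BirchSwinnertonDyer.Theorems.BiquadraticEisensteinDescentManinDatumSupercuspidalCMInertResolventOrbitSumJZero
  (phi_neg_iterate phi_rho_iterate phi_base orbit_injective univ_eq_insert_image zero_notMem_image resolventSum_rho_eq_six_mul)

/-! ## §1 Readout bookkeeping -/

section Valued

variable {Γ₀ : Type*} [LinearOrderedCommGroupWithZero Γ₀] (v : Valuation ℂ Γ₀)

/-- **Monomial readout.** `v(π)¹² = v 5`, `v q ≤ v(5)^e`, `12 − 2k ≤ 12e + j` ⇒ `v(q·π^j)⁶ ≤ v(5)^{6−k}`. [cite: Serre1979, Ch. IV §2 Prop. 7] -/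
theorem val_monomial_pow_six_le (h5 : v 5 < 1) {π : ℂ} (hπ : v π ^ 12 = v 5) {q : ℂ} {e j k : ℕ}
    (hq : v q ≤ v 5 ^ e) (hjk : 12 - 2 * k ≤ 12 * e + j) : v (q * π ^ j) ^ 6 ≤ v 5 ^ (6 - k) := by
  have h51 : v 5 ≤ 1 := h5.le
  have hπ1 : v π ≤ 1 := by
    by_contra h
    push Not at h
    have h12 : 1 < v π ^ 12 := one_lt_pow₀ h (by norm_num)
    rw [hπ] at h12
    exact absurd h5 (not_lt.mpr h12.le)
  have h12 : v (q * π ^ j) ^ 12 ≤ (v 5 ^ (6 - k)) ^ 2 := by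
    rw [Valuation.map_mul, Valuation.map_pow, mul_pow, ← pow_mul, mul_comm j 12, pow_mul, hπ]
    calc v q ^ 12 * v 5 ^ j ≤ (v 5 ^ e) ^ 12 * v 5 ^ j := mul_le_mul' (pow_le_pow_left₀ zero_le hq 12) le_rfl
      _ = v 5 ^ (12 * e + j) := by rw [← pow_mul, ← pow_add, mul_comm]
      _ ≤ v 5 ^ (12 - 2 * k) := pow_le_pow_right_of_le_one' h51 hjk
      _ ≤ v 5 ^ (2 * (6 - k)) := pow_le_pow_right_of_le_one' h51 (by omega)
      _ = (v 5 ^ (6 - k)) ^ 2 := by rw [mul_comm, pow_mul]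
  rw [show (12 : ℕ) = 6 * 2 from rfl, pow_mul] at h12
  exact le_of_pow_le_pow_left₀ two_ne_zero zero_le h12

/-- **Coefficient readout.** For `e ∈ ℕ`, `m ∈ ℤ` and `d ∈ ℕ` coprime to `5`: `v(5^e·m/d) ≤ v(5)^e` (`v m ≤ 1`, `v d = 1`). [folklore] -/
theorem val_coeff_le (h5 : v 5 < 1) (e : ℕ) (m : ℤ) {d : ℕ} (hd : Nat.Coprime d 5) :
    v ((5 : ℂ) ^ e * (m : ℂ) / (d : ℂ)) ≤ v 5 ^ e := by
  have hvd : v ((d : ℂ)) = 1 := val_natCast_eq_one_of_coprime v (p := 5) (by exact_mod_cast h5) hd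
  rw [map_div₀, Valuation.map_mul, Valuation.map_pow, hvd, div_one]
  exact mul_le_of_le_one_right' (val_intCast_le_one v m)

/-! ## §2 The seven readouts -/

/-- Readout of `Q_{1,4}`: `v(Q_{1,4}(q))⁶ ≤ v(5)^5` when `v(q)¹² = v 5`. [cite: Serre1979, Ch. IV §2 Prop. 7] -/
theorem readout_1_4 (h5 : v 5 < 1) {q : ℂ} (hq : v q ^ 12 = v 5) :
    v ((-128 : ℂ) * q ^ 10 + (800 : ℂ) * q ^ 7 + (-100 : ℂ) * q ^ 4 + (-275 : ℂ) * q) ^ 6 ≤ v 5 ^ 5 := by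
  have e : (-128 : ℂ) * q ^ 10 + (800 : ℂ) * q ^ 7 + (-100 : ℂ) * q ^ 4 + (-275 : ℂ) * q =
      ((5 : ℂ) ^ 0 * ((-128 : ℤ) : ℂ) / ((1 : ℕ) : ℂ)) * q ^ 10 + ((5 : ℂ) ^ 2 * ((32 : ℤ) : ℂ) / ((1 : ℕ) : ℂ)) * q ^ 7 + ((5 : ℂ) ^ 2 * ((-4 : ℤ) : ℂ) / ((1 : ℕ) : ℂ)) * q ^ 4 + ((5 : ℂ) ^ 2 * ((-11 : ℤ) : ℂ) / ((1 : ℕ) : ℂ)) * q ^ 1 := by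
    push_cast; ring
  rw [e]
  exact (val_add_pow_le v (val_add_pow_le v (val_add_pow_le v (val_monomial_pow_six_le v h5 hq (k := 1) (val_coeff_le v h5 0 (-128) (d := 1) (by norm_num)) (by norm_num)) (val_monomial_pow_six_le v h5 hq (k := 1) (val_coeff_le v h5 2 (32) (d := 1) (by norm_num)) (by norm_num))) (val_monomial_pow_six_le v h5 hq (k := 1) (val_coeff_le v h5 2 (-4) (d := 1) (by norm_num)) (by norm_num))) (val_monomial_pow_six_le v h5 hq (k := 1) (val_coeff_le v h5 2 (-11) (d := 1) (by norm_num)) (by norm_num)))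

/-- Readout of `Q_{1,7}`: `v(Q_{1,7}(q))⁶ ≤ v(5)^5` when `v(q)¹² = v 5`. [cite: Serre1979, Ch. IV §2 Prop. 7] -/
theorem readout_1_7 (h5 : v 5 < 1) {q : ℂ} (hq : v q ^ 12 = v 5) :
    v ((-784 : ℂ) * q ^ 10 + (4900 : ℂ) * q ^ 7 + (-1225/2 : ℂ) * q ^ 4 + (-13475/8 : ℂ) * q) ^ 6 ≤ v 5 ^ 5 := by
  have e : (-784 : ℂ) * q ^ 10 + (4900 : ℂ) * q ^ 7 + (-1225/2 : ℂ) * q ^ 4 + (-13475/8 : ℂ) * q =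
      ((5 : ℂ) ^ 0 * ((-784 : ℤ) : ℂ) / ((1 : ℕ) : ℂ)) * q ^ 10 + ((5 : ℂ) ^ 2 * ((196 : ℤ) : ℂ) / ((1 : ℕ) : ℂ)) * q ^ 7 + ((5 : ℂ) ^ 2 * ((-49 : ℤ) : ℂ) / ((2 : ℕ) : ℂ)) * q ^ 4 + ((5 : ℂ) ^ 2 * ((-539 : ℤ) : ℂ) / ((8 : ℕ) : ℂ)) * q ^ 1 := by
    push_cast; ring
  rw [e]
  exact (val_add_pow_le v (val_add_pow_le v (val_add_pow_le v (val_monomial_pow_six_le v h5 hq (k := 1) (val_coeff_le v h5 0 (-784) (d := 1) (by norm_num)) (by norm_num)) (val_monomial_pow_six_le v h5 hq (k := 1) (val_coeff_le v h5 2 (196) (d := 1) (by norm_num)) (by norm_num))) (val_monomial_pow_six_le v h5 hq (k := 1) (val_coeff_le v h5 2 (-49) (d := 2) (by norm_num)) (by norm_num))) (val_monomial_pow_six_le v h5 hq (k := 1) (val_coeff_le v h5 2 (-539) (d := 8) (by norm_num)) (by norm_num)))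

/-- Readout of `Q_{2,2}`: `v(Q_{2,2}(q))⁶ ≤ v(5)^4` when `v(q)¹² = v 5`. [cite: Serre1979, Ch. IV §2 Prop. 7] -/
theorem readout_2_2 (h5 : v 5 < 1) {q : ℂ} (hq : v q ^ 12 = v 5) :
    v ((8192/27 : ℂ) * q ^ 11 + (-17024/9 : ℂ) * q ^ 8 + (2240/9 : ℂ) * q ^ 5 + (13480/27 : ℂ) * q ^ 2) ^ 6 ≤ v 5 ^ 4 := by
  have e : (8192/27 : ℂ) * q ^ 11 + (-17024/9 : ℂ) * q ^ 8 + (2240/9 : ℂ) * q ^ 5 + (13480/27 : ℂ) * q ^ 2 =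
      ((5 : ℂ) ^ 0 * ((8192 : ℤ) : ℂ) / ((27 : ℕ) : ℂ)) * q ^ 11 + ((5 : ℂ) ^ 0 * ((-17024 : ℤ) : ℂ) / ((9 : ℕ) : ℂ)) * q ^ 8 + ((5 : ℂ) ^ 1 * ((448 : ℤ) : ℂ) / ((9 : ℕ) : ℂ)) * q ^ 5 + ((5 : ℂ) ^ 1 * ((2696 : ℤ) : ℂ) / ((27 : ℕ) : ℂ)) * q ^ 2 := by
    push_cast; ring
  rw [e]
  exact (val_add_pow_le v (val_add_pow_le v (val_add_pow_le v (val_monomial_pow_six_le v h5 hq (k := 2) (val_coeff_le v h5 0 (8192) (d := 27) (by norm_num)) (by norm_num)) (val_monomial_pow_six_le v h5 hq (k := 2) (val_coeff_le v h5 0 (-17024) (d := 9) (by norm_num)) (by norm_num))) (val_monomial_pow_six_le v h5 hq (k := 2) (val_coeff_le v h5 1 (448) (d := 9) (by norm_num)) (by norm_num))) (val_monomial_pow_six_le v h5 hq (k := 2) (val_coeff_le v h5 1 (2696) (d := 27) (by norm_num)) (by norm_num)))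

/-- Readout of `Q_{2,5}`: `v(Q_{2,5}(q))⁶ ≤ v(5)^4` when `v(q)¹² = v 5`. [cite: Serre1979, Ch. IV §2 Prop. 7] -/
theorem readout_2_5 (h5 : v 5 < 1) {q : ℂ} (hq : v q ^ 12 = v 5) :
    v ((35840/27 : ℂ) * q ^ 11 + (-74480/9 : ℂ) * q ^ 8 + (9800/9 : ℂ) * q ^ 5 + (58975/27 : ℂ) * q ^ 2) ^ 6 ≤ v 5 ^ 4 := by
  have e : (35840/27 : ℂ) * q ^ 11 + (-74480/9 : ℂ) * q ^ 8 + (9800/9 : ℂ) * q ^ 5 + (58975/27 : ℂ) * q ^ 2 =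
      ((5 : ℂ) ^ 1 * ((7168 : ℤ) : ℂ) / ((27 : ℕ) : ℂ)) * q ^ 11 + ((5 : ℂ) ^ 1 * ((-14896 : ℤ) : ℂ) / ((9 : ℕ) : ℂ)) * q ^ 8 + ((5 : ℂ) ^ 2 * ((392 : ℤ) : ℂ) / ((9 : ℕ) : ℂ)) * q ^ 5 + ((5 : ℂ) ^ 2 * ((2359 : ℤ) : ℂ) / ((27 : ℕ) : ℂ)) * q ^ 2 := by
    push_cast; ring
  rw [e]
  exact (val_add_pow_le v (val_add_pow_le v (val_add_pow_le v (val_monomial_pow_six_le v h5 hq (k := 2) (val_coeff_le v h5 1 (7168) (d := 27) (by norm_num)) (by norm_num)) (val_monomial_pow_six_le v h5 hq (k := 2) (val_coeff_le v h5 1 (-14896) (d := 9) (by norm_num)) (by norm_num))) (val_monomial_pow_six_le v h5 hq (k := 2) (val_coeff_le v h5 2 (392) (d := 9) (by norm_num)) (by norm_num))) (val_monomial_pow_six_le v h5 hq (k := 2) (val_coeff_le v h5 2 (2359) (d := 27) (by norm_num)) (by norm_num)))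

/-- Readout of `Q_{3,3}`: `v(Q_{3,3}(q))⁶ ≤ v(5)^3` when `v(q)¹² = v 5`. [cite: Serre1979, Ch. IV §2 Prop. 7] -/
theorem readout_3_3 (h5 : v 5 < 1) {q : ℂ} (hq : v q ^ 12 = v 5) :
    v ((-64/3 : ℂ) * q ^ 9 + (144 : ℂ) * q ^ 6 + (-80 : ℂ) * q ^ 3 + (-175/6 : ℂ)) ^ 6 ≤ v 5 ^ 3 := by
  have e : (-64/3 : ℂ) * q ^ 9 + (144 : ℂ) * q ^ 6 + (-80 : ℂ) * q ^ 3 + (-175/6 : ℂ) =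
      ((5 : ℂ) ^ 0 * ((-64 : ℤ) : ℂ) / ((3 : ℕ) : ℂ)) * q ^ 9 + ((5 : ℂ) ^ 0 * ((144 : ℤ) : ℂ) / ((1 : ℕ) : ℂ)) * q ^ 6 + ((5 : ℂ) ^ 1 * ((-16 : ℤ) : ℂ) / ((1 : ℕ) : ℂ)) * q ^ 3 + ((5 : ℂ) ^ 2 * ((-7 : ℤ) : ℂ) / ((6 : ℕ) : ℂ)) * q ^ 0 := by
    push_cast; ring
  rw [e]
  exact (val_add_pow_le v (val_add_pow_le v (val_add_pow_le v (val_monomial_pow_six_le v h5 hq (k := 3) (val_coeff_le v h5 0 (-64) (d := 3) (by norm_num)) (by norm_num)) (val_monomial_pow_six_le v h5 hq (k := 3) (val_coeff_le v h5 0 (144) (d := 1) (by norm_num)) (by norm_num))) (val_monomial_pow_six_le v h5 hq (k := 3) (val_coeff_le v h5 1 (-16) (d := 1) (by norm_num)) (by norm_num))) (val_monomial_pow_six_le v h5 hq (k := 3) (val_coeff_le v h5 2 (-7) (d := 6) (by norm_num)) (by norm_num)))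

/-- Readout of `Q_{4,1}`: `v(Q_{4,1}(q))⁶ ≤ v(5)^2` when `v(q)¹² = v 5`. [cite: Serre1979, Ch. IV §2 Prop. 7] -/
theorem readout_4_1 (h5 : v 5 < 1) {q : ℂ} (hq : v q ^ 12 = v 5) :
    v ((1024/27 : ℂ) * q ^ 10 + (-2176/9 : ℂ) * q ^ 7 + (592/9 : ℂ) * q ^ 4 + (1460/27 : ℂ) * q) ^ 6 ≤ v 5 ^ 2 := by
  have e : (1024/27 : ℂ) * q ^ 10 + (-2176/9 : ℂ) * q ^ 7 + (592/9 : ℂ) * q ^ 4 + (1460/27 : ℂ) * q =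
      ((5 : ℂ) ^ 0 * ((1024 : ℤ) : ℂ) / ((27 : ℕ) : ℂ)) * q ^ 10 + ((5 : ℂ) ^ 0 * ((-2176 : ℤ) : ℂ) / ((9 : ℕ) : ℂ)) * q ^ 7 + ((5 : ℂ) ^ 0 * ((592 : ℤ) : ℂ) / ((9 : ℕ) : ℂ)) * q ^ 4 + ((5 : ℂ) ^ 1 * ((292 : ℤ) : ℂ) / ((27 : ℕ) : ℂ)) * q ^ 1 := by
    push_cast; ring
  rw [e]
  exact (val_add_pow_le v (val_add_pow_le v (val_add_pow_le v (val_monomial_pow_six_le v h5 hq (k := 4) (val_coeff_le v h5 0 (1024) (d := 27) (by norm_num)) (by norm_num)) (val_monomial_pow_six_le v h5 hq (k := 4) (val_coeff_le v h5 0 (-2176) (d := 9) (by norm_num)) (by norm_num))) (val_monomial_pow_six_le v h5 hq (k := 4) (val_coeff_le v h5 0 (592) (d := 9) (by norm_num)) (by norm_num))) (val_monomial_pow_six_le v h5 hq (k := 4) (val_coeff_le v h5 1 (292) (d := 27) (by norm_num)) (by norm_num)))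

end Valued

/-! ## §3 Consequences of the character axioms: integrality of the values and vanishing of the total sum -/

/-- `ρ = e^{2πi/3}` is an algebraic integer (a root of `X³ − 1`). [folklore] -/
theorem rho_isIntegral : IsIntegral ℤ (UpperHalfPlane.ρ : ℂ) := by
  have hr : (UpperHalfPlane.ρ : ℂ) ^ 2 = -(UpperHalfPlane.ρ : ℂ) - 1 := UpperHalfPlane.ρ_sq
  have h3 : (UpperHalfPlane.ρ : ℂ) ^ 3 = 1 := by linear_combination ((UpperHalfPlane.ρ : ℂ) - 1) * hr
  refine ⟨Polynomial.X ^ 3 - Polynomial.C 1, Polynomial.monic_X_pow_sub_C _ (by norm_num), ?_⟩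
  simp [h3]

/-- **Integrality of the weight.** A weight with the axioms of `(·/5)₆^k` takes algebraic-integer values (`0` at `0`, a product of powers of `ρ`
and `−ρ²` on the `24` orbit points). [cite: IrelandRosen1982, Ch. 9 §3] -/
theorem phi_isIntegral {k : ℕ} (Φ : ZMod 5 × ZMod 5 → ℂ) (hΦ0 : Φ 0 = 0) (hΦone : Φ (0, 1) = 1) (hΦneg : ∀ d, Φ (-d) = Φ d)
    (hΦrho : ∀ d : ZMod 5 × ZMod 5, Φ (d.2 - d.1, -d.1) = (UpperHalfPlane.ρ : ℂ) ^ k * Φ d)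
    (hΦgen : ∀ d : ZMod 5 × ZMod 5, Φ (2 * d.1 - d.2, d.1 + d.2) = (-(UpperHalfPlane.ρ : ℂ) ^ 2) ^ k * Φ d)
    (d : ZMod 5 × ZMod 5) : IsIntegral ℤ (Φ d) := by
  have hρ := rho_isIntegral
  have hX : IsIntegral ℤ ((-(UpperHalfPlane.ρ : ℂ) ^ 2) ^ k) := ((hρ.pow 2).neg).pow k
  obtain ⟨b0, b1, b2, b3⟩ := phi_base Φ hΦone hΦgen
  have hbase : ∀ a : Fin 4, IsIntegral ℤ (Φ (![((0 : ZMod 5), (1 : ZMod 5)), (4, 1), (2, 0), (4, 2)] a)) := by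
    intro a
    fin_cases a
    · simpa [b0] using (isIntegral_one : IsIntegral ℤ (1 : ℂ))
    · simpa [b1] using hX
    · simpa [b2] using hX.pow 2
    · simpa [b3] using hX.pow 3
  have hmem : d ∈ insert (0 : ZMod 5 × ZMod 5) (Finset.univ.image (fun x : Fin 2 × Fin 3 × Fin 4 ↦
      (fun d : ZMod 5 × ZMod 5 ↦ -d)^[x.1.val] ((fun d : ZMod 5 × ZMod 5 ↦ ((d.2 - d.1, -d.1) : ZMod 5 × ZMod 5))^[x.2.1.val]
        (![((0 : ZMod 5), (1 : ZMod 5)), (4, 1), (2, 0), (4, 2)] x.2.2)))) := by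
    rw [← univ_eq_insert_image]; exact Finset.mem_univ d
  rcases Finset.mem_insert.mp hmem with h | h
  · rw [h, hΦ0]; exact isIntegral_zero
  · obtain ⟨⟨s, j, a⟩, -, hx⟩ := Finset.mem_image.mp h
    rw [← hx]
    simp only
    rw [phi_neg_iterate Φ hΦneg, phi_rho_iterate Φ hΦrho]
    exact (hρ.pow _).mul (hbase a)

/-- **Vanishing of the total sum.** For `1 ≤ k ≤ 5` a weight with the axioms of `(·/5)₆^k` has `Σ_d Φ(d) = 0`
(`= 2·(1 + ρ^k + ρ^{2k})·(1 + X + X² + X³)`, `X = (−ρ²)^k`: the first factor vanishes for `3 ∤ k`, the second for `k = 3`).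
[cite: IrelandRosen1982, Ch. 9 §3] -/
theorem phi_sum_eq_zero {k : ℕ} (hk1 : 1 ≤ k) (hk5 : k ≤ 5)
    (Φ : ZMod 5 × ZMod 5 → ℂ) (hΦ0 : Φ 0 = 0) (hΦone : Φ (0, 1) = 1) (hΦneg : ∀ d, Φ (-d) = Φ d)
    (hΦrho : ∀ d : ZMod 5 × ZMod 5, Φ (d.2 - d.1, -d.1) = (UpperHalfPlane.ρ : ℂ) ^ k * Φ d)
    (hΦgen : ∀ d : ZMod 5 × ZMod 5, Φ (2 * d.1 - d.2, d.1 + d.2) = (-(UpperHalfPlane.ρ : ℂ) ^ 2) ^ k * Φ d) :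
    ∑ d : ZMod 5 × ZMod 5, Φ d = 0 := by
  set N : ZMod 5 × ZMod 5 → ZMod 5 × ZMod 5 := fun d ↦ -d with hN
  set U : ZMod 5 × ZMod 5 → ZMod 5 × ZMod 5 := fun d ↦ ((d.2 - d.1, -d.1) : ZMod 5 × ZMod 5) with hU
  set e : Fin 4 → ZMod 5 × ZMod 5 := ![((0 : ZMod 5), (1 : ZMod 5)), (4, 1), (2, 0), (4, 2)] with he
  set φ : Fin 2 × Fin 3 × Fin 4 → ZMod 5 × ZMod 5 := fun x ↦ N^[x.1.val] (U^[x.2.1.val] (e x.2.2)) with hφ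
  have hinj : Function.Injective φ := orbit_injective
  have huniv : (Finset.univ : Finset (ZMod 5 × ZMod 5)) = insert 0 (Finset.univ.image φ) := univ_eq_insert_image
  have h0 : (0 : ZMod 5 × ZMod 5) ∉ Finset.univ.image φ := zero_notMem_image
  have hval : ∀ x : Fin 2 × Fin 3 × Fin 4, Φ (φ x) =
      (UpperHalfPlane.ρ : ℂ) ^ (x.2.1.val * k) * ((-(UpperHalfPlane.ρ : ℂ) ^ 2) ^ k) ^ x.2.2.val := by
    rintro ⟨s, j, a⟩
    simp only [hφ, hN, hU]
    rw [phi_neg_iterate Φ hΦneg, phi_rho_iterate Φ hΦrho]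
    obtain ⟨b0, b1, b2, b3⟩ := phi_base Φ hΦone hΦgen
    fin_cases a <;> simp [he, b0, b1, b2, b3]
  have hsum : ∑ d : ZMod 5 × ZMod 5, Φ d = Φ 0 + ∑ x : Fin 2 × Fin 3 × Fin 4, Φ (φ x) := by
    rw [show (∑ d : ZMod 5 × ZMod 5, Φ d) = ∑ d ∈ (Finset.univ : Finset (ZMod 5 × ZMod 5)), Φ d from rfl, huniv,
      Finset.sum_insert h0, Finset.sum_image (fun x _ y _ h ↦ hinj h)]
  rw [hsum, hΦ0, zero_add]
  simp_rw [hval]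
  simp_rw [Fintype.sum_prod_type]
  simp only [Finset.sum_const, Finset.card_univ, Fintype.card_fin, nsmul_eq_mul, Fin.sum_univ_four, Fin.sum_univ_three]
  have h3v : ((3 : Fin 4) : ℕ) = 3 := rfl
  simp only [Fin.val_zero, Fin.val_one, Fin.val_two, h3v, pow_zero, pow_one, one_mul, zero_mul, mul_one]
  push_cast
  have hr : (UpperHalfPlane.ρ : ℂ) ^ 2 = -(UpperHalfPlane.ρ : ℂ) - 1 := UpperHalfPlane.ρ_sq
  interval_cases k
  · linear_combination ((2 : ℂ) + (-2 : ℂ) * (UpperHalfPlane.ρ : ℂ) ^ 2 + (2 : ℂ) * (UpperHalfPlane.ρ : ℂ) ^ 4 + (-2 : ℂ) * (UpperHalfPlane.ρ : ℂ) ^ 6) * hr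
  · linear_combination ((2 : ℂ) + (-2 : ℂ) * (UpperHalfPlane.ρ : ℂ) ^ 1 + (2 : ℂ) * (UpperHalfPlane.ρ : ℂ) ^ 2 + (2 : ℂ) * (UpperHalfPlane.ρ : ℂ) ^ 4 + (-2 : ℂ) * (UpperHalfPlane.ρ : ℂ) ^ 5 + (2 : ℂ) * (UpperHalfPlane.ρ : ℂ) ^ 6 + (2 : ℂ) * (UpperHalfPlane.ρ : ℂ) ^ 8 + (-2 : ℂ) * (UpperHalfPlane.ρ : ℂ) ^ 9 + (2 : ℂ) * (UpperHalfPlane.ρ : ℂ) ^ 10 + (2 : ℂ) * (UpperHalfPlane.ρ : ℂ) ^ 12 + (-2 : ℂ) * (UpperHalfPlane.ρ : ℂ) ^ 13 + (2 : ℂ) * (UpperHalfPlane.ρ : ℂ) ^ 14) * hr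
  · linear_combination ((2 : ℂ) + (-2 : ℂ) * (UpperHalfPlane.ρ : ℂ) ^ 1 + (4 : ℂ) * (UpperHalfPlane.ρ : ℂ) ^ 3 + (-4 : ℂ) * (UpperHalfPlane.ρ : ℂ) ^ 4 + (4 : ℂ) * (UpperHalfPlane.ρ : ℂ) ^ 6 + (-4 : ℂ) * (UpperHalfPlane.ρ : ℂ) ^ 7 + (2 : ℂ) * (UpperHalfPlane.ρ : ℂ) ^ 9 + (-2 : ℂ) * (UpperHalfPlane.ρ : ℂ) ^ 10 + (2 : ℂ) * (UpperHalfPlane.ρ : ℂ) ^ 12 + (-2 : ℂ) * (UpperHalfPlane.ρ : ℂ) ^ 13 + (4 : ℂ) * (UpperHalfPlane.ρ : ℂ) ^ 15 + (-4 : ℂ) * (UpperHalfPlane.ρ : ℂ) ^ 16 + (4 : ℂ) * (UpperHalfPlane.ρ : ℂ) ^ 18 + (-4 : ℂ) * (UpperHalfPlane.ρ : ℂ) ^ 19 + (2 : ℂ) * (UpperHalfPlane.ρ : ℂ) ^ 21 + (-2 : ℂ) * (UpperHalfPlane.ρ : ℂ) ^ 22) * hr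
  · linear_combination ((2 : ℂ) + (-2 : ℂ) * (UpperHalfPlane.ρ : ℂ) ^ 1 + (2 : ℂ) * (UpperHalfPlane.ρ : ℂ) ^ 3 + (-2 : ℂ) * (UpperHalfPlane.ρ : ℂ) ^ 5 + (2 : ℂ) * (UpperHalfPlane.ρ : ℂ) ^ 6 + (2 : ℂ) * (UpperHalfPlane.ρ : ℂ) ^ 8 + (-2 : ℂ) * (UpperHalfPlane.ρ : ℂ) ^ 9 + (2 : ℂ) * (UpperHalfPlane.ρ : ℂ) ^ 11 + (-2 : ℂ) * (UpperHalfPlane.ρ : ℂ) ^ 13 + (2 : ℂ) * (UpperHalfPlane.ρ : ℂ) ^ 14 + (2 : ℂ) * (UpperHalfPlane.ρ : ℂ) ^ 16 + (-2 : ℂ) * (UpperHalfPlane.ρ : ℂ) ^ 17 + (2 : ℂ) * (UpperHalfPlane.ρ : ℂ) ^ 19 + (-2 : ℂ) * (UpperHalfPlane.ρ : ℂ) ^ 21 + (2 : ℂ) * (UpperHalfPlane.ρ : ℂ) ^ 22 + (2 : ℂ) * (UpperHalfPlane.ρ : ℂ) ^ 24 + (-2 : ℂ) * (UpperHalfPlane.ρ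 : ℂ) ^ 25 + (2 : ℂ) * (UpperHalfPlane.ρ : ℂ) ^ 27 + (-2 : ℂ) * (UpperHalfPlane.ρ : ℂ) ^ 29 + (2 : ℂ) * (UpperHalfPlane.ρ : ℂ) ^ 30) * hr
  · linear_combination ((2 : ℂ) + (-2 : ℂ) * (UpperHalfPlane.ρ : ℂ) ^ 1 + (2 : ℂ) * (UpperHalfPlane.ρ : ℂ) ^ 3 + (-2 : ℂ) * (UpperHalfPlane.ρ : ℂ) ^ 4 + (2 : ℂ) * (UpperHalfPlane.ρ : ℂ) ^ 5 + (-2 : ℂ) * (UpperHalfPlane.ρ : ℂ) ^ 7 + (2 : ℂ) * (UpperHalfPlane.ρ : ℂ) ^ 8 + (-2 : ℂ) * (UpperHalfPlane.ρ : ℂ) ^ 10 + (2 : ℂ) * (UpperHalfPlane.ρ : ℂ) ^ 11 + (-2 : ℂ) * (UpperHalfPlane.ρ : ℂ) ^ 13 + (2 : ℂ) * (UpperHalfPlane.ρ : ℂ) ^ 14 + (-2 : ℂ) * (UpperHalfPlane.ρ : ℂ) ^ 15 + (2 : ℂ) * (UpperHalfPlane.ρ : ℂ) ^ 17 + (-2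 : ℂ) * (UpperHalfPlane.ρ : ℂ) ^ 18 + (2 : ℂ) * (UpperHalfPlane.ρ : ℂ) ^ 20 + (-2 : ℂ) * (UpperHalfPlane.ρ : ℂ) ^ 21 + (2 : ℂ) * (UpperHalfPlane.ρ : ℂ) ^ 23 + (-2 : ℂ) * (UpperHalfPlane.ρ : ℂ) ^ 24 + (2 : ℂ) * (UpperHalfPlane.ρ : ℂ) ^ 25 + (-2 : ℂ) * (UpperHalfPlane.ρ : ℂ) ^ 27 + (2 : ℂ) * (UpperHalfPlane.ρ : ℂ) ^ 28 + (-2 : ℂ) * (UpperHalfPlane.ρ : ℂ) ^ 30 + (2 : ℂ) * (UpperHalfPlane.ρ : ℂ) ^ 31 + (-2 : ℂ) * (UpperHalfPlane.ρ : ℂ) ^ 33 + (2 : ℂ) * (UpperHalfPlane.ρ : ℂ) ^ 34 + (-2 : ℂ) * (UpperHalfPlane.ρ : ℂ) ^ 35 + (2 : ℂ) * (UpperHalfPlane.ρ : ℂ) ^ 37 + (-2 : ℂ) * (UpperHalfPlane.ρ : ℂ) ^ 38) * hr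

/-! ## §4 RES₅ and the core for sextic-character weights -/

/-- ★ **RES₅fin for sextic-character weights.** For `1 ≤ k ≤ 5` and `Φ : (ℤ/5)² → ℂ` with `Φ 0 = 0`, `Φ(0,1) = 1`, `Φ(−d) = Φ(d)`,
`Φ(d₂−d₁, −d₁) = ρ^kΦ(d)`, `Φ(2d₁−d₂, d₁+d₂) = (−ρ²)^kΦ(d)`: for every `n ≥ 1` with `3 ∣ k + 2n` and `n < 2(6 − k)` and every valuation `v`
of `ℂ` with `v 5 < 1`, `v(Σ_d Φ(d)·X(t_d)⁻ⁿ)⁶ ≤ v(5)^{6−k}`. [cite: Serre1979, Ch. IV §2 Prop. 7] -/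
theorem resolventBound_rho_small_of_character {k : ℕ} (hk1 : 1 ≤ k) (hk5 : k ≤ 5)
    (Φ : ZMod 5 × ZMod 5 → ℂ) (hΦ0 : Φ 0 = 0) (hΦone : Φ (0, 1) = 1) (hΦneg : ∀ d, Φ (-d) = Φ d)
    (hΦrho : ∀ d : ZMod 5 × ZMod 5, Φ (d.2 - d.1, -d.1) = (UpperHalfPlane.ρ : ℂ) ^ k * Φ d)
    (hΦgen : ∀ d : ZMod 5 × ZMod 5, Φ (2 * d.1 - d.2, d.1 + d.2) = (-(UpperHalfPlane.ρ : ℂ) ^ 2) ^ k * Φ d) :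
    ∀ n : ℕ, 1 ≤ n → 3 ∣ k + 2 * n → n < 2 * (6 - k) →
      ∀ (Γ₀ : Type) [LinearOrderedCommGroupWithZero Γ₀] (v : Valuation ℂ Γ₀), v 5 < 1 →
        v (∑ d : ZMod 5 × ZMod 5, Φ d *
          (℘[ofUpperHalfPlane UpperHalfPlane.ρ] (((d.1.val : ℂ) * UpperHalfPlane.ρ + (d.2.val : ℂ)) / 5) /
            (((2 : ℝ) ^ (2 / 3 : ℝ) * Real.Gamma (1 / 3) ^ 3 / (4 * Real.pi) : ℝ) : ℂ) ^ 2)⁻¹ ^ n) ^ 6 ≤ v 5 ^ (6 - k) := by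
  intro n hn1 hdvd hlt Γ₀ _ v hv
  obtain ⟨h01, -, -, -⟩ := e_ne_zero
  obtain ⟨-, -, hπ12, -⟩ := val_weierstrassP_five_div_rho v hv (divPointRho_notMem h01) (five_mul_divPointRho_mem ((0, 1) : ZMod 5 × ZMod 5))
  have hF := F_of_divPointRho h01
  have hr : (UpperHalfPlane.ρ : ℂ) ^ 2 = -(UpperHalfPlane.ρ : ℂ) - 1 := UpperHalfPlane.ρ_sq
  rw [resolventSum_rho_eq_six_mul Φ hΦ0 hΦone hΦneg hΦrho hΦgen hdvd, pi_e_one, pi_e_two, pi_e_three]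
  -- enumerate the seven pairs
  interval_cases k <;> interval_cases n <;> try omega
  · -- (1,1)
    have key := sum_1_1 (p := (℘[ofUpperHalfPlane UpperHalfPlane.ρ] ((((((0, 1) : ZMod 5 × ZMod 5)).1.val : ℂ) * UpperHalfPlane.ρ + ((((0, 1) : ZMod 5 × ZMod 5)).2.val : ℂ)) / 5) / (((2 : ℝ) ^ (2 / 3 : ℝ) * Real.Gamma (1 / 3) ^ 3 / (4 * Real.pi) : ℝ) : ℂ) ^ 2)⁻¹) hr
    have e6 : ∀ x y z w : ℂ, 6 * (x + (-(UpperHalfPlane.ρ : ℂ) ^ 2) ^ 1 * y + ((-(UpperHalfPlane.ρ : ℂ) ^ 2) ^ 1) ^ 2 * z +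
        ((-(UpperHalfPlane.ρ : ℂ) ^ 2) ^ 1) ^ 3 * w) = 6 * (x + (-(UpperHalfPlane.ρ : ℂ) ^ 2) ^ (1 * 1) * y +
        (-(UpperHalfPlane.ρ : ℂ) ^ 2) ^ (2 * 1) * z + (-(UpperHalfPlane.ρ : ℂ) ^ 2) ^ (3 * 1) * w) := by intro x y z w; ring
    rw [e6, key, Valuation.map_zero, zero_pow (by norm_num)]
    exact zero_le
  · -- (1,4)
    have key := sum_1_4 (p := (℘[ofUpperHalfPlane UpperHalfPlane.ρ] ((((((0, 1) : ZMod 5 × ZMod 5)).1.val : ℂ) * UpperHalfPlane.ρ + ((((0, 1) : ZMod 5 × ZMod 5)).2.val : ℂ)) / 5) / (((2 : ℝ) ^ (2 / 3 : ℝ) * Real.Gamma (1 / 3) ^ 3 / (4 * Real.pi) : ℝ) : ℂ) ^ 2)⁻¹) hF hr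
    have e6 : ∀ x y z w : ℂ, 6 * (x + (-(UpperHalfPlane.ρ : ℂ) ^ 2) ^ 1 * y + ((-(UpperHalfPlane.ρ : ℂ) ^ 2) ^ 1) ^ 2 * z +
        ((-(UpperHalfPlane.ρ : ℂ) ^ 2) ^ 1) ^ 3 * w) = 6 * (x + (-(UpperHalfPlane.ρ : ℂ) ^ 2) ^ (1 * 1) * y +
        (-(UpperHalfPlane.ρ : ℂ) ^ 2) ^ (2 * 1) * z + (-(UpperHalfPlane.ρ : ℂ) ^ 2) ^ (3 * 1) * w) := by intro x y z w; ring
    rw [e6, key]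
    exact readout_1_4 v hv hπ12
  · -- (1,7)
    have key := sum_1_7 (p := (℘[ofUpperHalfPlane UpperHalfPlane.ρ] ((((((0, 1) : ZMod 5 × ZMod 5)).1.val : ℂ) * UpperHalfPlane.ρ + ((((0, 1) : ZMod 5 × ZMod 5)).2.val : ℂ)) / 5) / (((2 : ℝ) ^ (2 / 3 : ℝ) * Real.Gamma (1 / 3) ^ 3 / (4 * Real.pi) : ℝ) : ℂ) ^ 2)⁻¹) hF hr
    have e6 : ∀ x y z w : ℂ, 6 * (x + (-(UpperHalfPlane.ρ : ℂ) ^ 2) ^ 1 * y + ((-(UpperHalfPlane.ρ : ℂ) ^ 2) ^ 1) ^ 2 * z +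
        ((-(UpperHalfPlane.ρ : ℂ) ^ 2) ^ 1) ^ 3 * w) = 6 * (x + (-(UpperHalfPlane.ρ : ℂ) ^ 2) ^ (1 * 1) * y +
        (-(UpperHalfPlane.ρ : ℂ) ^ 2) ^ (2 * 1) * z + (-(UpperHalfPlane.ρ : ℂ) ^ 2) ^ (3 * 1) * w) := by intro x y z w; ring
    rw [e6, key]
    exact readout_1_7 v hv hπ12
  · -- (2,2)
    have key := sum_2_2 (p := (℘[ofUpperHalfPlane UpperHalfPlane.ρ] ((((((0, 1) : ZMod 5 × ZMod 5)).1.val : ℂ) * UpperHalfPlane.ρ + ((((0, 1) : ZMod 5 × ZMod 5)).2.val : ℂ)) / 5) / (((2 : ℝ) ^ (2 / 3 : ℝ) * Real.Gamma (1 / 3) ^ 3 / (4 * Real.pi) : ℝ) : ℂ) ^ 2)⁻¹) hF hr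
    have e6 : ∀ x y z w : ℂ, 6 * (x + (-(UpperHalfPlane.ρ : ℂ) ^ 2) ^ 2 * y + ((-(UpperHalfPlane.ρ : ℂ) ^ 2) ^ 2) ^ 2 * z +
        ((-(UpperHalfPlane.ρ : ℂ) ^ 2) ^ 2) ^ 3 * w) = 6 * (x + (-(UpperHalfPlane.ρ : ℂ) ^ 2) ^ (1 * 2) * y +
        (-(UpperHalfPlane.ρ : ℂ) ^ 2) ^ (2 * 2) * z + (-(UpperHalfPlane.ρ : ℂ) ^ 2) ^ (3 * 2) * w) := by intro x y z w; ring
    rw [e6, key]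
    exact readout_2_2 v hv hπ12
  · -- (2,5)
    have key := sum_2_5 (p := (℘[ofUpperHalfPlane UpperHalfPlane.ρ] ((((((0, 1) : ZMod 5 × ZMod 5)).1.val : ℂ) * UpperHalfPlane.ρ + ((((0, 1) : ZMod 5 × ZMod 5)).2.val : ℂ)) / 5) / (((2 : ℝ) ^ (2 / 3 : ℝ) * Real.Gamma (1 / 3) ^ 3 / (4 * Real.pi) : ℝ) : ℂ) ^ 2)⁻¹) hF hr
    have e6 : ∀ x y z w : ℂ, 6 * (x + (-(UpperHalfPlane.ρ : ℂ) ^ 2) ^ 2 * y + ((-(UpperHalfPlane.ρ : ℂ) ^ 2) ^ 2) ^ 2 * z +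
        ((-(UpperHalfPlane.ρ : ℂ) ^ 2) ^ 2) ^ 3 * w) = 6 * (x + (-(UpperHalfPlane.ρ : ℂ) ^ 2) ^ (1 * 2) * y +
        (-(UpperHalfPlane.ρ : ℂ) ^ 2) ^ (2 * 2) * z + (-(UpperHalfPlane.ρ : ℂ) ^ 2) ^ (3 * 2) * w) := by intro x y z w; ring
    rw [e6, key]
    exact readout_2_5 v hv hπ12
  · -- (3,3)
    have key := sum_3_3 (p := (℘[ofUpperHalfPlane UpperHalfPlane.ρ] ((((((0, 1) : ZMod 5 × ZMod 5)).1.val : ℂ) * UpperHalfPlane.ρ + ((((0, 1) : ZMod 5 × ZMod 5)).2.val : ℂ)) / 5) / (((2 : ℝ) ^ (2 / 3 : ℝ) * Real.Gamma (1 / 3) ^ 3 / (4 * Real.pi) : ℝ) : ℂ) ^ 2)⁻¹) hF hr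
    have e6 : ∀ x y z w : ℂ, 6 * (x + (-(UpperHalfPlane.ρ : ℂ) ^ 2) ^ 3 * y + ((-(UpperHalfPlane.ρ : ℂ) ^ 2) ^ 3) ^ 2 * z +
        ((-(UpperHalfPlane.ρ : ℂ) ^ 2) ^ 3) ^ 3 * w) = 6 * (x + (-(UpperHalfPlane.ρ : ℂ) ^ 2) ^ (1 * 3) * y +
        (-(UpperHalfPlane.ρ : ℂ) ^ 2) ^ (2 * 3) * z + (-(UpperHalfPlane.ρ : ℂ) ^ 2) ^ (3 * 3) * w) := by intro x y z w; ring
    rw [e6, key]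
    exact readout_3_3 v hv hπ12
  · -- (4,1)
    have key := sum_4_1 (p := (℘[ofUpperHalfPlane UpperHalfPlane.ρ] ((((((0, 1) : ZMod 5 × ZMod 5)).1.val : ℂ) * UpperHalfPlane.ρ + ((((0, 1) : ZMod 5 × ZMod 5)).2.val : ℂ)) / 5) / (((2 : ℝ) ^ (2 / 3 : ℝ) * Real.Gamma (1 / 3) ^ 3 / (4 * Real.pi) : ℝ) : ℂ) ^ 2)⁻¹) hr
    have e6 : ∀ x y z w : ℂ, 6 * (x + (-(UpperHalfPlane.ρ : ℂ) ^ 2) ^ 4 * y + ((-(UpperHalfPlane.ρ : ℂ) ^ 2) ^ 4) ^ 2 * z +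
        ((-(UpperHalfPlane.ρ : ℂ) ^ 2) ^ 4) ^ 3 * w) = 6 * (x + (-(UpperHalfPlane.ρ : ℂ) ^ 2) ^ (1 * 4) * y +
        (-(UpperHalfPlane.ρ : ℂ) ^ 2) ^ (2 * 4) * z + (-(UpperHalfPlane.ρ : ℂ) ^ 2) ^ (3 * 4) * w) := by intro x y z w; ring
    rw [e6, key]
    exact readout_4_1 v hv hπ12

/-- ★★ **The CM core of the `j = 0` cell, for sextic-character weights.** For `1 ≤ k ≤ 5` and `Φ : (ℤ/5)² → ℂ` satisfying the axioms of
`(·/5)₆^k` (`Φ 0 = 0`, `Φ(0,1) = 1`, `Φ(−d) = Φ(d)`, `Φ(ρ·d) = ρ^kΦ(d)`, `Φ((1−ρ)·d) = (−ρ²)^kΦ(d)`; NOTHING ELSE —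
`Σ_d Φ(d) = 0` and integrality of the values are consequences, §3): for every `M′` coprime to `5` and every `w ∈ ℂ` with `M′w ∈ Λ = ℤρ + ℤ` there is `s ∈ ℕ` with `5 ∤ s` and
`s·(Σ_d Φ(d)·E₁(w − t_d; Λ))/(ϖ₁·5^{(6−k)/6}) ∈ ℤ̄` (`t_d = (d₁ρ + d₂)/5`, `ϖ₁ = 2^{2/3}Γ(1/3)³/(4π)`, `E₁ = PeriodPair.eisensteinE₁`).
[cite: Rubin1999, §7.4 Prop. 7.12] [cite: Serre1979, Ch. IV §2 Prop. 7] -/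
theorem core_rho_of_character {k : ℕ} (hk1 : 1 ≤ k) (hk5 : k ≤ 5)
    (Φ : ZMod 5 × ZMod 5 → ℂ) (hΦ0 : Φ 0 = 0) (hΦone : Φ (0, 1) = 1) (hΦneg : ∀ d, Φ (-d) = Φ d)
    (hΦrho : ∀ d : ZMod 5 × ZMod 5, Φ (d.2 - d.1, -d.1) = (UpperHalfPlane.ρ : ℂ) ^ k * Φ d)
    (hΦgen : ∀ d : ZMod 5 × ZMod 5, Φ (2 * d.1 - d.2, d.1 + d.2) = (-(UpperHalfPlane.ρ : ℂ) ^ 2) ^ k * Φ d)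
    (M' : ℕ) (hM5 : Nat.Coprime M' 5) (w : ℂ) (hMw : (M' : ℂ) * w ∈ (ofUpperHalfPlane UpperHalfPlane.ρ).lattice) :
    ∃ s : ℕ, ¬ 5 ∣ s ∧ IsIntegral ℤ ((s : ℂ) *
      (∑ d : ZMod 5 × ZMod 5, Φ d * (ofUpperHalfPlane UpperHalfPlane.ρ).eisensteinE₁
          (w - ((d.1.val : ℂ) * UpperHalfPlane.ρ + (d.2.val : ℂ)) / 5)) /
        ((((2 : ℝ) ^ (2 / 3 : ℝ) * Real.Gamma (1 / 3) ^ 3 / (4 * Real.pi) : ℝ) : ℂ) * (5 : ℂ) ^ (((6 - k : ℕ) : ℂ) / 6))) :=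
  core_rho_of_smallResolventBound hk1 hk5 Φ hΦ0 hΦneg (phi_sum_eq_zero hk1 hk5 Φ hΦ0 hΦone hΦneg hΦrho hΦgen) hΦrho
    (phi_isIntegral Φ hΦ0 hΦone hΦneg hΦrho hΦgen)
    (resolventBound_rho_small_of_character hk1 hk5 Φ hΦ0 hΦone hΦneg hΦrho hΦgen) M' hM5 w hMw

end Summit.BirchSwinnertonDyer.BirchSwinnertonDyer.Theorems.BiquadraticEisensteinDescentManinDatumSupercuspidalCMInertResolventCertificateJZero

end
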